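import Summits.AnomalousDissipation.AnomalousDissipation.Theses.TwoAndHalfD
import Literature.Analysis.FluidPDE.TwoHalfNavierStokes
import Literature.Analysis.FluidPDE.PassiveScalarForced
import Literature.Analysis.FluidPDE.VorticitySliceIdentity
import Literature.Analysis.FluidPDE.TimeAverageEnstrophy
import Literature.Analysis.FluidPDE.NSVorticityDifference
import Literature.Analysis.FunctionSpaces.TorusAxisAverage
import Summits.AnomalousDissipation.AnomalousDissipation.Theorems.TwoAndHalfDTwohalfdNegWeakCurlWitness
import Summits.AnomalousDissipation.AnomalousDissipation.Theorems.TwoAndHalfDTwohalfdNegWeakVorticityNonlinear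

/-!
# Stub `stub_vorticityTransport` (S6-co/A) of the line `log-kantorovich-enstrophy-transfer` for the crux
# `TwoAndHalfD.TwohalfdNeg` (stmt-AnomalousDissipation-0211): the weak VORTICITY FORMULATION of
# two-dimensional Leray–Hopf solutions from `H¹` data

For `ν > 0`, a smooth steady force `g` on `T²`, a datum `v₀ ∈ L² ∩ H¹` and a global Leray–Hopf
solution `v`: there is a mean-zero `ω₀ ∈ L²` (the weak curl of `v₀`) such that on every horizon
`[0,T)` some `ω : ℝ → T² → ℝ` is a weak solution, in the accepted sense
`Torus.IsWeakScalarTransportForcedOn T ν v (curl g) ω₀ ω`, of the vorticity equation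
`∂ₜω + v·∇ω = νΔω + curl g`, lying in `L^∞_t L²_x` and carrying the enstrophy,
`‖ω t‖₂² = eGradNormSq (v t)` for a.e. `t`.

Proof. The vorticity witness is `WeakCurlWitness.stub_weakCurlWitness` (jointly measurable weak
curl with the `L^∞L²` bound and the norm identity). Test the Leray–Hopf weak formulation of `v`
against the divergence-free space–time field `∇^⊥φ = -∂₁φ e₀ + ∂₀φ e₁`
(`Literature/Analysis/FluidPDE/PerpGradientTestField`); slice by slice the Navier–Stokes
integrand integrates to minus the vorticity-transport integrand
(`Torus.vorticity_slice_identity`, whose nonlinear hypothesis is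
`WeakVorticityNonlinear.stub_weakVorticityNonlinear` at the a.e. times where `v t ∈ H¹` is weakly
divergence free), the datum term is the weak curl of `v₀`, and the two scalar pairings are
integrable in time (joint measurability + the Leray–Hopf `L^∞L²` bounds), so the time integrals
split. The remaining conjuncts (`L¹L²` drift, `vω ∈ L¹`, bounded source) follow from the
Leray–Hopf bounds. This is the two-dimensional vorticity formulation for weak solutions
(Majda–Bertozzi 2002, §2.1 and Prop. 2.7; Kuksin–Shirikyan 2012, §2.1), previously in the tree
only for classical solutions (cf. `Cruxes/RelaxingFamily/Disproof.lean`, N2). Supports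
stmt-AnomalousDissipation-0211 (feeds the orphan composition `twohalfdNeg_twoHalf_coscalar_of` of
`Cruxes/TwohalfdNeg/Lines/log_kantorovich_enstrophy_transfer.lean`).
-/

namespace Summit.AnomalousDissipation.AnomalousDissipation.Theorems.TwohalfdNeg.VorticityTransport

open MeasureTheory Filter Topology Set Function
open scoped ENNReal NNReal
open Literature.Analysis.FunctionSpaces Literature.Analysis.FluidPDE

set_option linter.dupNamespace false

/-- **S6-co/A `stub_vorticityTransport` — the weak vorticity formulation of two-dimensional
Leray–Hopf solutions from `H¹` data.** For `ν > 0`, a smooth steady force `g`, `v₀ ∈ L² ∩ H¹` and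
a global Leray–Hopf `v` there is a mean-zero `ω₀ ∈ L²` such that on every `[0,T)` some `ω` is a
weak solution `Torus.IsWeakScalarTransportForcedOn T ν v (curl g) ω₀ ω` of
`∂ₜω + v·∇ω = νΔω + curl g` with `ω t ∈ L²` and `‖ω t‖₂² = eGradNormSq (v t)` for a.e. `t`. -/
theorem stub_vorticityTransport :
    ∀ (ν : ℝ) (g : UnitAddTorus (Fin 2) → EuclideanSpace ℝ (Fin 2)),
      0 < ν → Torus.IsSmooth g → Torus.IsDivFree g → Torus.HasZeroMean g →
      ∀ (v₀ : UnitAddTorus (Fin 2) → EuclideanSpace ℝ (Fin 2))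
        (v : ℝ → UnitAddTorus (Fin 2) → EuclideanSpace ℝ (Fin 2)),
        MemLp v₀ 2 volume → Torus.eGradNormSq v₀ < ⊤ →
        Torus.IsGlobalLerayHopf ν (fun _ => g) v₀ v →
        ∃ ω₀ : UnitAddTorus (Fin 2) → ℝ, MemLp ω₀ 2 volume ∧ (∫ x, ω₀ x = 0) ∧
          ∀ T : ℝ, 0 < T → ∃ ω : ℝ → UnitAddTorus (Fin 2) → ℝ,
            Torus.IsWeakScalarTransportForcedOn T ν v
              (fun _ x => Torus.partialDeriv 0 g x 1 - Torus.partialDeriv 1 g x 0) ω₀ ω ∧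
            ∀ᵐ t ∂(volume.restrict (Set.Ioo 0 T)),
              MemLp (ω t) 2 volume ∧ ENNReal.ofReal (Torus.scalarL2Sq (ω t)) = Torus.eGradNormSq (v t) := by
  intro ν g hν hgs hgd hgz v₀ v hv₀ hv₀H1 hLH
  obtain ⟨⟨ω₀, hω₀, hω₀m, hω₀c⟩, hWT⟩ :=
    WeakCurlWitness.stub_weakCurlWitness ν g hν hgs hgd hgz v₀ v hv₀ hv₀H1 hLH
  refine ⟨ω₀, hω₀, hω₀m, fun T hT => ?_⟩
  obtain ⟨ω, hωm, ⟨C, hC⟩, hωae⟩ := hWT T hT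
  refine ⟨ω, ?_, ?_⟩
  swap
  · filter_upwards [hωae] with t ht using ⟨ht.1, ht.2.2⟩
  have hL := hLH T hT
  obtain ⟨M, hM⟩ := hL.energy_bound
  have hss : Torus.IsSmooth (fun x => Torus.partialDeriv 0 g x 1 - Torus.partialDeriv 1 g x 0) :=
    ((hgs.partialDeriv 0).apply 1).sub ((hgs.partialDeriv 1).apply 0)
  obtain ⟨Ks, hKs⟩ := Torus.exists_forall_norm_le_of_continuous hss.continuous
  have hKs0 : 0 ≤ Ks := (norm_nonneg _).trans (hKs 0)
  have hmem : ∀ᵐ t ∂(volume.restrict (Ioo 0 T)), t ∈ Ioo 0 T := ae_restrict_mem measurableSet_Ioo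
  have hslice : ∀ t ∈ Ioo 0 T, MemLp (v t) 2 volume := fun t ht => hL.memLp t ⟨ht.1.le, ht.2.le⟩
  have hH1 : ∀ᵐ t ∂(volume.restrict (Ioo 0 T)), Torus.eGradNormSq (v t) < ⊤ := by
    filter_upwards [ae_restrict_of_ae hLH.ae_eGradNormSq_lt_top, hmem] with t ht htm
    exact ht htm.1
  refine
    { aestronglyMeasurable := hωm
      aestronglyMeasurable_velocity := hL.weak.1
      aestronglyMeasurable_source :=
        (Torus.isSmoothSpaceTimeOn_const hss univ).aestronglyMeasurable_stLift measurableSet_Ioo (subset_univ _)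
      ae_lintegral_sq_le := ⟨C, hC⟩
      lintegral_velocity_lt_top := ?_
      lintegral_mul_lt_top := ?_
      lintegral_source_lt_top := ?_
      ae_isWeaklyDivFree := hL.weak.2.2.1
      weak_eq := ?_ }
  · -- `v ∈ L¹(0,T; L²)`
    calc ∫⁻ t in Ioo 0 T, (∫⁻ x, ‖v t x‖ₑ ^ 2) ^ (1 / 2 : ℝ)
        ≤ ∫⁻ _ in Ioo 0 T, ((M : ℝ≥0∞)) ^ (1 / 2 : ℝ) :=
          lintegral_mono_ae (by
            filter_upwards [hM] with t ht
            exact ENNReal.rpow_le_rpow ht (by norm_num))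
      _ < ⊤ := by
          rw [lintegral_const, Measure.restrict_apply_univ]
          exact ENNReal.mul_lt_top (ENNReal.rpow_lt_top_of_nonneg (by norm_num) ENNReal.coe_ne_top) measure_Ioo_lt_top
  · -- `v ω ∈ L¹((0,T) × T²)`
    have hpt : ∀ᵐ t ∂(volume.restrict (Ioo 0 T)), ∫⁻ x, ‖v t x‖ₑ * ‖ω t x‖ₑ ≤ (M : ℝ≥0∞) + C := by
      filter_upwards [hM, hC, hmem] with t hvt hωt ht
      have hvm : AEMeasurable (fun x => ‖v t x‖ₑ ^ 2) volume :=
        (hslice t ht).1.aemeasurable.enorm.pow_const _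
      calc ∫⁻ x, ‖v t x‖ₑ * ‖ω t x‖ₑ ≤ ∫⁻ x, (‖v t x‖ₑ ^ 2 + ‖ω t x‖ₑ ^ 2) :=
            lintegral_mono fun x => Literature.Analysis.FluidPDE.ennreal_mul_le_sq_add_sq _ _
        _ = (∫⁻ x, ‖v t x‖ₑ ^ 2) + ∫⁻ x, ‖ω t x‖ₑ ^ 2 := lintegral_add_left' hvm _
        _ ≤ M + C := add_le_add hvt hωt
    calc ∫⁻ t in Ioo 0 T, ∫⁻ x, ‖v t x‖ₑ * ‖ω t x‖ₑ ≤ ∫⁻ _ in Ioo 0 T, ((M : ℝ≥0∞) + C) :=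
          lintegral_mono_ae hpt
      _ < ⊤ := by
          rw [lintegral_const, Measure.restrict_apply_univ]
          exact ENNReal.mul_lt_top (ENNReal.add_lt_top.2 ⟨ENNReal.coe_lt_top, ENNReal.coe_lt_top⟩) measure_Ioo_lt_top
  · -- the source is bounded
    have hin : ∀ t : ℝ, ∫⁻ x, ‖(fun (_ : ℝ) (x : UnitAddTorus (Fin 2)) =>
        Torus.partialDeriv 0 g x 1 - Torus.partialDeriv 1 g x 0) t x‖ₑ ≤ ENNReal.ofReal Ks := by
      intro t
      calc ∫⁻ x, ‖(fun (_ : ℝ) (x : UnitAddTorus (Fin 2)) =>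
            Torus.partialDeriv 0 g x 1 - Torus.partialDeriv 1 g x 0) t x‖ₑ
          ≤ ∫⁻ _ : UnitAddTorus (Fin 2), ENNReal.ofReal Ks := lintegral_mono fun x => by
              rw [← ofReal_norm]
              exact ENNReal.ofReal_le_ofReal (hKs x)
        _ = ENNReal.ofReal Ks := by rw [lintegral_const, measure_univ, mul_one]
    calc ∫⁻ t in Ioo 0 T, ∫⁻ x, ‖(fun (_ : ℝ) (x : UnitAddTorus (Fin 2)) =>
          Torus.partialDeriv 0 g x 1 - Torus.partialDeriv 1 g x 0) t x‖ₑ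
        ≤ ∫⁻ _ in Ioo 0 T, ENNReal.ofReal Ks := lintegral_mono fun t => hin t
      _ < ⊤ := by
          rw [lintegral_const, Measure.restrict_apply_univ]
          exact ENNReal.mul_lt_top ENNReal.ofReal_lt_top measure_Ioo_lt_top
  · -- the weak identity
    intro φ hφ
    have hNS := hL.weak.2.2.2 _ (Torus.PerpGrad.isSpaceTimeTest hφ) (Torus.PerpGrad.isDivFreeTest hφ)
    beta_reduce at hNS
    -- the slice identity for a.e. `t`
    have hE : ∀ᵐ t ∂(volume.restrict (Ioo 0 T)),
        ∫ x, (inner ℝ (v t x) (Torus.timeDeriv (fun t x =>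
              (-Torus.partialDeriv 1 (φ t) x) • EuclideanSpace.single (0 : Fin 2) (1 : ℝ) +
                Torus.partialDeriv 0 (φ t) x • EuclideanSpace.single (1 : Fin 2) (1 : ℝ)) t x) +
            inner ℝ (v t x) (Torus.convect (v t) (fun x =>
              (-Torus.partialDeriv 1 (φ t) x) • EuclideanSpace.single (0 : Fin 2) (1 : ℝ) +
                Torus.partialDeriv 0 (φ t) x • EuclideanSpace.single (1 : Fin 2) (1 : ℝ)) x) +
            ν * inner ℝ (v t x) (Torus.laplacian (fun x =>
              (-Torus.partialDeriv 1 (φ t) x) • EuclideanSpace.single (0 : Fin 2) (1 : ℝ) +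
                Torus.partialDeriv 0 (φ t) x • EuclideanSpace.single (1 : Fin 2) (1 : ℝ)) x) +
            inner ℝ (g x) ((-Torus.partialDeriv 1 (φ t) x) • EuclideanSpace.single (0 : Fin 2) (1 : ℝ) +
                Torus.partialDeriv 0 (φ t) x • EuclideanSpace.single (1 : Fin 2) (1 : ℝ))) =
          -((∫ x, ω t x * (Torus.timeDeriv φ t x + inner ℝ (v t x) (Torus.gradient (φ t) x) +
              ν * Torus.laplacian (φ t) x)) +
            ∫ x, (Torus.partialDeriv 0 g x 1 - Torus.partialDeriv 1 g x 0) * φ t x) := by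
      filter_upwards [hmem, hωae, hH1, hL.weak.2.2.1] with t ht hω hH hdiv
      exact Torus.vorticity_slice_identity hgs hφ (hslice t ht) hω.1 hω.2.1 t
        (WeakVorticityNonlinear.stub_weakVorticityNonlinear (v t) (ω t) (φ t) _ (hslice t ht) hH hdiv hω.1
          hω.2.1 (hφ.isSmooth_slice t) (fun x => Torus.PerpGrad.smul_e_add_apply_zero _ _)
          (fun x => Torus.PerpGrad.smul_e_add_apply_one _ _))
    -- the datum term
    have hD : ∫ x, inner ℝ (v₀ x) ((-Torus.partialDeriv 1 (φ 0) x) • EuclideanSpace.single (0 : Fin 2) (1 : ℝ) +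
        Torus.partialDeriv 0 (φ 0) x • EuclideanSpace.single (1 : Fin 2) (1 : ℝ)) = -∫ x, ω₀ x * φ 0 x := by
      rw [show (∫ x, ω₀ x * φ 0 x) = ∫ x, φ 0 x * ω₀ x from integral_congr_ae (ae_of_all _ fun x => mul_comm _ _),
        ← hω₀c _ (hφ.isSmooth_slice 0)]
      refine integral_congr_ae (ae_of_all _ fun x => ?_)
      beta_reduce
      rw [Torus.PerpGrad.inner_smul_e_add]
      ring
    -- uniform bounds for the test data on `[0, T]`
    obtain ⟨Kp, hKp⟩ := (hφ.timeDeriv.isSmoothSpaceTimeOn univ).exists_norm_le_of_isCompact isCompact_Icc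
      (subset_univ (Icc 0 T))
    obtain ⟨KL, hKL⟩ := ((hφ.isSmoothSpaceTimeOn univ).laplacian uniqueDiffOn_univ).exists_norm_le_of_isCompact
      isCompact_Icc (subset_univ (Icc 0 T))
    obtain ⟨Kg, hKg⟩ := ((hφ.isSmoothSpaceTimeOn univ).gradient uniqueDiffOn_univ).exists_norm_le_of_isCompact
      isCompact_Icc (subset_univ (Icc 0 T))
    obtain ⟨Kq, hKq⟩ := (hφ.isSmoothSpaceTimeOn univ).exists_norm_le_of_isCompact isCompact_Icc
      (subset_univ (Icc 0 T))
    have hKg0 : 0 ≤ Kg := (norm_nonneg _).trans (hKg 0 ⟨le_rfl, hT.le⟩ 0)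
    -- joint measurability of the two scalar integrands
    have hωu := Torus.aestronglyMeasurable_uncurry_of_stLift_prod hωm
    have hvu := Torus.aestronglyMeasurable_uncurry_of_stLift_prod hL.weak.1
    have hc1 : Continuous (uncurry (Torus.timeDeriv φ)) :=
      Torus.continuous_uncurry_of_continuous_stLift hφ.timeDeriv.1.continuous
    have hcg : Continuous (uncurry fun t => Torus.gradient (φ t)) :=
      Torus.continuous_uncurry_of_continuous_stLift
        ((hφ.isSmoothSpaceTimeOn univ).gradient uniqueDiffOn_univ).continuous_stLift_of_univ
    have hcL : Continuous (uncurry fun t => Torus.laplacian (φ t)) :=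
      Torus.continuous_uncurry_of_continuous_stLift
        ((hφ.isSmoothSpaceTimeOn univ).laplacian uniqueDiffOn_univ).continuous_stLift_of_univ
    have hcφ : Continuous (uncurry φ) := Torus.continuous_uncurry_of_continuous_stLift hφ.1.continuous
    have hAm : AEStronglyMeasurable (fun t => ∫ x, ω t x * (Torus.timeDeriv φ t x +
        inner ℝ (v t x) (Torus.gradient (φ t) x) + ν * Torus.laplacian (φ t) x)) (volume.restrict (Ioo 0 T)) := by
      have h : AEStronglyMeasurable (fun p : ℝ × UnitAddTorus (Fin 2) => ω p.1 p.2 * (Torus.timeDeriv φ p.1 p.2 +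
          inner ℝ (v p.1 p.2) (Torus.gradient (φ p.1) p.2) + ν * Torus.laplacian (φ p.1) p.2))
          ((volume.restrict (Ioo 0 T)).prod volume) :=
        hωu.mul ((hc1.aestronglyMeasurable.add (hvu.inner hcg.aestronglyMeasurable)).add
          (hcL.aestronglyMeasurable.const_mul ν))
      exact h.integral_prod_right'
    have hSm : AEStronglyMeasurable (fun t => ∫ x, (Torus.partialDeriv 0 g x 1 - Torus.partialDeriv 1 g x 0) * φ t x)
        (volume.restrict (Ioo 0 T)) := by
      have h : AEStronglyMeasurable (fun p : ℝ × UnitAddTorus (Fin 2) =>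
          (Torus.partialDeriv 0 g p.2 1 - Torus.partialDeriv 1 g p.2 0) * φ p.1 p.2)
          ((volume.restrict (Ioo 0 T)).prod volume) :=
        ((hss.continuous.comp continuous_snd).mul hcφ).aestronglyMeasurable
      exact h.integral_prod_right'
    -- a.e. bounds of the two scalar integrands
    have hAb : ∀ᵐ t ∂(volume.restrict (Ioo 0 T)), ‖∫ x, ω t x * (Torus.timeDeriv φ t x +
        inner ℝ (v t x) (Torus.gradient (φ t) x) + ν * Torus.laplacian (φ t) x)‖ ≤
        (Kp + |ν| * KL) * (1 + C) + Kg * (C + M) := by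
      filter_upwards [hmem, hωae, hC, hM] with t ht hω hωC hvM
      have htI : t ∈ Icc 0 T := ⟨ht.1.le, ht.2.le⟩
      have hω2 : ∫ x, ω t x ^ 2 ≤ (C : ℝ) := by
        have h := Torus.PerpGrad.integral_norm_sq_le_of_lintegral_le hω.1 hωC
        simpa only [Real.norm_eq_abs, sq_abs] using h
      have hv2 : ∫ x, ‖v t x‖ ^ 2 ≤ (M : ℝ) := Torus.PerpGrad.integral_norm_sq_le_of_lintegral_le (hslice t ht) hvM
      have hv2i : Integrable (fun x => ‖v t x‖ ^ 2) volume :=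
        (memLp_two_iff_integrable_sq_norm (hslice t ht).1).1 (hslice t ht)
      have hb1 : Integrable (fun x => 1 + ω t x ^ 2) volume := (integrable_const _).add hω.1.integrable_sq
      have hb2 : Integrable (fun x => ω t x ^ 2 + ‖v t x‖ ^ 2) volume := hω.1.integrable_sq.add hv2i
      have hb1' : Integrable (fun x => (Kp + |ν| * KL) * (1 + ω t x ^ 2)) volume := hb1.const_mul _
      have hb2' : Integrable (fun x => Kg * (ω t x ^ 2 + ‖v t x‖ ^ 2)) volume := hb2.const_mul _
      have hbi : Integrable (fun x => (Kp + |ν| * KL) * (1 + ω t x ^ 2) + Kg * (ω t x ^ 2 + ‖v t x‖ ^ 2)) volume :=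
        hb1'.add hb2'
      refine (norm_integral_le_of_norm_le hbi (ae_of_all _ fun x => ?_)).trans ?_
      · have h1 : ‖Torus.timeDeriv φ t x‖ ≤ Kp := hKp t htI x
        have h2 : ‖Torus.laplacian (φ t) x‖ ≤ KL := hKL t htI x
        have h3 : ‖Torus.gradient (φ t) x‖ ≤ Kg := hKg t htI x
        have hKp0 : 0 ≤ Kp := (norm_nonneg _).trans h1
        have hKL0 : 0 ≤ KL := (norm_nonneg _).trans h2
        rw [Real.norm_eq_abs] at h1 h2
        rw [norm_mul, Real.norm_eq_abs]
        have h4 : ‖Torus.timeDeriv φ t x + inner ℝ (v t x) (Torus.gradient (φ t) x) + ν * Torus.laplacian (φ t) x‖ ≤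
            Kp + ‖v t x‖ * Kg + |ν| * KL := by
          refine (norm_add_le _ _).trans (add_le_add ((norm_add_le _ _).trans (add_le_add ?_ ?_)) ?_)
          · rwa [Real.norm_eq_abs]
          · exact (norm_inner_le_norm _ _).trans (mul_le_mul_of_nonneg_left h3 (norm_nonneg _))
          · rw [norm_mul, Real.norm_eq_abs, Real.norm_eq_abs]
            exact mul_le_mul_of_nonneg_left h2 (abs_nonneg _)
        calc |ω t x| * ‖Torus.timeDeriv φ t x + inner ℝ (v t x) (Torus.gradient (φ t) x) + ν * Torus.laplacian (φ t) x‖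
            ≤ |ω t x| * (Kp + ‖v t x‖ * Kg + |ν| * KL) := mul_le_mul_of_nonneg_left h4 (abs_nonneg _)
          _ = (Kp + |ν| * KL) * |ω t x| + Kg * (|ω t x| * ‖v t x‖) := by ring
          _ ≤ (Kp + |ν| * KL) * (1 + ω t x ^ 2) + Kg * (ω t x ^ 2 + ‖v t x‖ ^ 2) := by
              refine add_le_add (mul_le_mul_of_nonneg_left ?_ (by positivity)) (mul_le_mul_of_nonneg_left ?_ hKg0)
              · nlinarith [sq_nonneg (|ω t x| - 1), sq_abs (ω t x), abs_nonneg (ω t x)]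
              · nlinarith [sq_nonneg (|ω t x| - ‖v t x‖), sq_abs (ω t x), abs_nonneg (ω t x), norm_nonneg (v t x)]
      · have hω2i : Integrable (fun x => ω t x ^ 2) volume := hω.1.integrable_sq
        have hci : Integrable (fun _ : UnitAddTorus (Fin 2) => (1 : ℝ)) volume := integrable_const _
        rw [integral_add hb1' hb2', integral_const_mul, integral_const_mul, integral_add hci hω2i,
          integral_add hω2i hv2i, integral_const, probReal_univ, smul_eq_mul, one_mul]
        have hKp0 : 0 ≤ Kp := (norm_nonneg _).trans (hKp t htI 0)
        have hKL0 : 0 ≤ KL := (norm_nonneg _).trans (hKL t htI 0)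
        have hA0 : 0 ≤ Kp + |ν| * KL := by positivity
        nlinarith
    have hSb : ∀ᵐ t ∂(volume.restrict (Ioo 0 T)),
        ‖∫ x, (Torus.partialDeriv 0 g x 1 - Torus.partialDeriv 1 g x 0) * φ t x‖ ≤ Ks * Kq := by
      filter_upwards [hmem] with t ht
      have htI : t ∈ Icc 0 T := ⟨ht.1.le, ht.2.le⟩
      refine (norm_integral_le_of_norm_le (integrable_const (Ks * Kq)) (ae_of_all _ fun x => ?_)).trans ?_
      · rw [norm_mul]
        exact mul_le_mul (hKs x) (hKq t htI x) (norm_nonneg _) hKs0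
      · rw [integral_const, probReal_univ, smul_eq_mul, one_mul]
    have hAi : Integrable (fun t => ∫ x, ω t x * (Torus.timeDeriv φ t x +
        inner ℝ (v t x) (Torus.gradient (φ t) x) + ν * Torus.laplacian (φ t) x)) (volume.restrict (Ioo 0 T)) :=
      Integrable.mono' (integrableOn_const (measure_Ioo_lt_top (a := (0 : ℝ)) (b := T)).ne) hAm hAb
    have hSi : Integrable (fun t => ∫ x, (Torus.partialDeriv 0 g x 1 - Torus.partialDeriv 1 g x 0) * φ t x)
        (volume.restrict (Ioo 0 T)) :=
      Integrable.mono' (integrableOn_const (measure_Ioo_lt_top (a := (0 : ℝ)) (b := T)).ne) hSm hSb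
    -- conclusion
    rw [integral_congr_ae hE, integral_neg, integral_add hAi hSi, hD] at hNS
    show (∫ t in Ioo 0 T, ∫ x, ω t x * (Torus.timeDeriv φ t x + inner ℝ (v t x) (Torus.gradient (φ t) x) +
        ν * Torus.laplacian (φ t) x)) +
      (∫ t in Ioo 0 T, ∫ x, (Torus.partialDeriv 0 g x 1 - Torus.partialDeriv 1 g x 0) * φ t x) +
        ∫ x, ω₀ x * φ 0 x = 0
    linarith

end Summit.AnomalousDissipation.AnomalousDissipation.Theorems.TwohalfdNeg.VorticityTransport
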